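import Literature.Analysis.FluidPDE.LocalLerayPairingContinuity
import Literature.Analysis.FluidPDE.NSSuitableESS
import Literature.Analysis.FluidPDE.MollifiedLimits
import HarnessLib

/-!
# Time pairings of distributional Navier–Stokes solutions on a time cylinder `(a, b) × B_R(x₀)`

Analysis/FluidPDE support file (theorems only, no definitions, no named facts). It is the first
of three files proving the **strong `L²` compactness of velocities on a cylinder** (the
Aubin–Lions / Friedrichs step of the compactness of suitable weak solutions: Temam 1977, Ch. III,
Thm. 2.1 with Lemma 2.1; Lin 1998, Thm. 2.2; Caffarelli–Kohn–Nirenberg 1982, Appendix; used by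
Bradshaw–Tsai 2019, §4.3 "As usual … `vₖ` converges to `v` … in `L²(0,T;L²(B₁))`"), which in turn
serves the discharge of `Literature.Analysis.FluidPDE.bradshawTsai2019_cylinderCompactness`.

For a distributional (pressure-explicit, unforced) solution `(v, π)` of the Navier–Stokes equations on
the open cylinder `W = (a, b) × B_R(x₀) ⊆ ℝ × ℝ³` (`IsDistributionalNSSolutionOn (timeCylinder Ω a b)`,
`Ω` the ball) with `v ∈ L²(W)` and `π ∈ L¹(W)`, and a vector test field `η ∈ C_c^∞(B_R(x₀); ℝ³)`,
the **pairing** `g_η(t) = ∫_{B} ⟪v(t), η⟫` and the **tested remainder**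
`f_η(t) = ∫_{B} (⟪v, Dη v⟫ + ν ⟪v, Δη⟫ + π div η)(t)` are integrable on `(a, b)` and satisfy
`∫_{(a,b)} (χ' g_η + χ f_η) dt = 0` for every `χ ∈ C_c^∞((a, b))`
(`IsDistributionalNSSolutionOn.setIntegral_deriv_mul_pairing_add_eq_zero_cylinder`): test the
momentum equation with `χ(t) η(x)` and apply Fubini on `W` — the cylinder analogue of the slab
statement `setIntegral_deriv_mul_pairing_add_eq_zero_slab` (`LocalLerayPairingContinuity.lean`;
Robinson–Rodrigo–Sadowski 2016, Lemma 13.8; Galdi 2000, Lemma 2.1; Temam 1977, Ch. III, Lemma 1.1).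
Also recorded: the `L²(W)` bound of `v` from an `L^∞_t L²_x` slice bound (Tonelli), the `L¹(W)`
bound of the pressure from an `L^{3/2}(W)` bound (Hölder), and the resulting uniform bounds on
`g_η` (a.e. in `t`) and on `∫_J |f_η|` over subintervals `J` (the equicontinuity modulus of the
continuous representative of `g_η`, Temam 1977, Ch. III, (2.35)–(2.36)).

## References

* R. Temam, *Navier–Stokes equations* (1977), Ch. III, §2, Lemma 2.1, Thm. 2.1. [Temam1977]
* F. Lin, CPAM 51 (1998), Thm. 2.2. [Lin1998]
* J. C. Robinson, J. L. Rodrigo, W. Sadowski (2016), Lemma 13.8. [RobinsonRodrigoSadowski2016]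
* Z. Bradshaw, T.-P. Tsai, Analysis & PDE 12 (2019), §4.3. [BradshawTsai2019]
-/

noncomputable section

open MeasureTheory Set Function Filter Topology TopologicalSpace Metric intervalIntegral
open scoped NNReal ENNReal InnerProductSpace RealInnerProductSpace Laplacian

namespace Literature.Analysis.FluidPDE

section Cylinder

variable {x₀ : (EuclideanSpace ℝ (Fin 3))} {R a b ν : ℝ} {v : ℝ → (EuclideanSpace ℝ (Fin 3)) → (EuclideanSpace ℝ (Fin 3))} {π : ℝ → (EuclideanSpace ℝ (Fin 3)) → ℝ}

/-! ### Measure-theoretic preliminaries on the cylinder `(a, b) × B_R(x₀)` -/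

/-- The restriction of Lebesgue measure to the cylinder `(a, b) × B` is the product of the
restrictions. [folklore] -/
theorem volume_restrict_cylinder_eq_prod (a b : ℝ) (B : Set (EuclideanSpace ℝ (Fin 3))) :
    (volume : Measure (ℝ × (EuclideanSpace ℝ (Fin 3)))).restrict (Ioo a b ×ˢ B) =
      ((volume : Measure ℝ).restrict (Ioo a b)).prod ((volume : Measure (EuclideanSpace ℝ (Fin 3))).restrict B) := by
  rw [Measure.prod_restrict, ← Measure.volume_eq_prod]

/-- The cylinder `(a, b) × B_R(x₀)` has finite Lebesgue measure. [folklore] -/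
theorem volume_cylinder_lt_top (a b : ℝ) (x₀ : (EuclideanSpace ℝ (Fin 3))) (R : ℝ) :
    volume (Ioo a b ×ˢ ball x₀ R) < ∞ :=
  lt_of_le_of_lt (measure_mono (prod_mono Ioo_subset_Icc_self ball_subset_closedBall))
    (isCompact_Icc.prod (isCompact_closedBall x₀ R)).measure_lt_top

/-- The cylinder `(a, b) × B_R(x₀)` carries a finite restricted Lebesgue measure (a theorem, to
be invoked with `haveI`). [folklore] -/
theorem isFiniteMeasure_restrict_cylinder (a b : ℝ) (x₀ : (EuclideanSpace ℝ (Fin 3))) (R : ℝ) :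
    IsFiniteMeasure ((volume : Measure (ℝ × (EuclideanSpace ℝ (Fin 3)))).restrict (Ioo a b ×ˢ ball x₀ R)) :=
  isFiniteMeasure_restrict.2 (volume_cylinder_lt_top a b x₀ R).ne

/-- **Tonelli on the cylinder**: `∬_{(a,b)×B} F = ∫_{(a,b)} ∫_B F(t, ·) dt` for a.e.-measurable
`F ≥ 0`. [folklore] -/
theorem setLIntegral_cylinder_eq {F : ℝ × (EuclideanSpace ℝ (Fin 3)) → ℝ≥0∞} {B : Set (EuclideanSpace ℝ (Fin 3))}
    (hF : AEMeasurable F ((volume : Measure (ℝ × (EuclideanSpace ℝ (Fin 3)))).restrict (Ioo a b ×ˢ B))) :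
    ∫⁻ z in Ioo a b ×ˢ B, F z = ∫⁻ t in Ioo a b, ∫⁻ x in B, F (t, x) := by
  rw [volume_restrict_cylinder_eq_prod] at hF ⊢
  rw [lintegral_prod _ hF]

/-- **`L^∞_t L²_x` slice bounds give an `L²` bound on the cylinder**:
`∬_{(a,b)×B} |v|² ≤ C · |(a,b)|` if `∫_B |v(t)|² ≤ C` for a.e. `t ∈ (a, b)`. [folklore] -/
theorem setLIntegral_cylinder_enorm_sq_le {B : Set (EuclideanSpace ℝ (Fin 3))}
    (hm : AEStronglyMeasurable (uncurry v) ((volume : Measure (ℝ × (EuclideanSpace ℝ (Fin 3)))).restrict (Ioo a b ×ˢ B)))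
    {C : ℝ≥0∞} (hE : ∀ᵐ t ∂((volume : Measure ℝ).restrict (Ioo a b)), ∫⁻ x in B, ‖v t x‖ₑ ^ 2 ≤ C) :
    ∫⁻ z in Ioo a b ×ˢ B, ‖v z.1 z.2‖ₑ ^ 2 ≤ C * volume (Ioo a b) := by
  have h := setLIntegral_cylinder_eq (a := a) (b := b) (B := B)
    (F := fun z => ‖uncurry v z‖ₑ ^ 2) (hm.aemeasurable.enorm.pow_const 2)
  simp only [uncurry] at h
  rw [h]
  calc ∫⁻ t in Ioo a b, ∫⁻ x in B, ‖v t x‖ₑ ^ 2 ≤ ∫⁻ _ in Ioo a b, C := lintegral_mono_ae hE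
    _ = C * volume (Ioo a b) := setLIntegral_const _ _

/-- A function with `∫⁻ ‖f‖ₑ² < ∞` which is a.e.-strongly measurable is in `L²`. [folklore] -/
theorem memLp_two_of_aestronglyMeasurable_of_lintegral_sq_lt_top {X : Type*} [MeasurableSpace X] {μ : Measure X}
    {F : Type*} [NormedAddCommGroup F] {f : X → F} (hm : AEStronglyMeasurable f μ)
    (hfin : ∫⁻ x, ‖f x‖ₑ ^ 2 ∂μ < ∞) : MemLp f 2 μ := by
  refine ⟨hm, ?_⟩
  have h2 : eLpNorm f 2 μ ^ 2 < ∞ := by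
    rw [MollifiedLimits.eLpNorm_two_pow_two]
    exact hfin
  by_contra htop
  rw [not_lt, top_le_iff] at htop
  rw [htop, ENNReal.top_pow two_ne_zero] at h2
  exact lt_irrefl _ h2

/-- **Hölder against `1`**: an `L^{3/2}` bound on a set of finite measure gives an `L¹` bound,
`∫_S |π| ≤ |S|^{1/3} (∫_S |π|^{3/2})^{2/3}`. [folklore] -/
theorem setLIntegral_enorm_le_of_three_halves {X : Type*} [MeasurableSpace X] {μ : Measure X}
    {S : Set X} {p : X → ℝ} (hm : AEStronglyMeasurable p (μ.restrict S)) :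
    ∫⁻ z in S, ‖p z‖ₑ ∂μ ≤ μ S ^ (1 / 3 : ℝ) * (∫⁻ z in S, ‖p z‖ₑ ^ (3 / 2 : ℝ) ∂μ) ^ (2 / 3 : ℝ) := by
  have h32 : (1 : ℝ≥0∞) ≤ 3 / 2 := by
    rw [ENNReal.le_div_iff_mul_le (by norm_num) (by norm_num)]; norm_num
  have h := eLpNorm_le_eLpNorm_mul_rpow_measure_univ (p := 1) (q := (3 / 2 : ℝ≥0∞))
    (μ := μ.restrict S) (f := p) h32 hm
  have e32 : (3 / 2 : ℝ≥0∞).toReal = 3 / 2 := by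
    rw [ENNReal.toReal_div]; norm_num
  rw [eLpNorm_one_eq_lintegral_enorm, Measure.restrict_apply_univ, ENNReal.toReal_one, e32,
    eLpNorm_eq_lintegral_rpow_enorm_toReal (by norm_num) (ENNReal.div_ne_top (by norm_num) (by norm_num)),
    e32] at h
  calc ∫⁻ z in S, ‖p z‖ₑ ∂μ
      ≤ (∫⁻ z in S, ‖p z‖ₑ ^ (3 / 2 : ℝ) ∂μ) ^ (1 / (3 / 2 : ℝ)) * μ S ^ (1 / (1 : ℝ) - 1 / (3 / 2 : ℝ)) := h
    _ = μ S ^ (1 / 3 : ℝ) * (∫⁻ z in S, ‖p z‖ₑ ^ (3 / 2 : ℝ) ∂μ) ^ (2 / 3 : ℝ) := by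
        rw [mul_comm]; norm_num


/-! ### The pairing integrands on the cylinder -/

/-- **The pairing integrands are integrable on the cylinder.** For `v ∈ L²(W)`, `π ∈ L¹(W)`,
`W = (a, b) × B_R(x₀)`, and a test field `η ∈ C_c^∞(B_R(x₀); ℝ³)`, both `⟪v, η⟫` and
`⟪v, Dη v⟫ + ν ⟪v, Δη⟫ + π div η` are integrable on `W` (bounded coefficients; the quadratic term is
controlled by `|v|² ∈ L¹(W)`). [folklore] -/
theorem integrable_pairing_integrands_cylinder
    (hv : MemLp (uncurry v) 2 ((volume : Measure (ℝ × (EuclideanSpace ℝ (Fin 3)))).restrict (Ioo a b ×ˢ ball x₀ R)))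
    (hπ : Integrable (uncurry π) ((volume : Measure (ℝ × (EuclideanSpace ℝ (Fin 3)))).restrict (Ioo a b ×ˢ ball x₀ R)))
    {η : (EuclideanSpace ℝ (Fin 3)) → (EuclideanSpace ℝ (Fin 3))} (hη : FunctionSpaces.IsTestFunctionOn (⟨ball x₀ R, isOpen_ball⟩ : Opens (EuclideanSpace ℝ (Fin 3))) η) :
    Integrable (fun z : ℝ × (EuclideanSpace ℝ (Fin 3)) => ⟪v z.1 z.2, η z.2⟫)
        ((volume : Measure (ℝ × (EuclideanSpace ℝ (Fin 3)))).restrict (Ioo a b ×ˢ ball x₀ R)) ∧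
      Integrable (fun z : ℝ × (EuclideanSpace ℝ (Fin 3)) =>
          ⟪v z.1 z.2, fderiv ℝ η z.2 (v z.1 z.2)⟫ + ν * ⟪v z.1 z.2, Δ η z.2⟫ +
            π z.1 z.2 * VectorCalculus.divergence η z.2)
        ((volume : Measure (ℝ × (EuclideanSpace ℝ (Fin 3)))).restrict (Ioo a b ×ˢ ball x₀ R)) := by
  set μS : Measure (ℝ × (EuclideanSpace ℝ (Fin 3))) := (volume : Measure (ℝ × (EuclideanSpace ℝ (Fin 3)))).restrict (Ioo a b ×ˢ ball x₀ R) with hμS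
  obtain ⟨K₀, K₁, K₂, hK₀, hK₁, hK₂⟩ := exists_bounds_of_isTestFunctionOn hη
  have hη2 : ContDiff ℝ 2 η := hη.contDiff.of_le (by norm_cast)
  have cD : Continuous (fderiv ℝ η) := hη.contDiff.continuous_fderiv (by simp)
  have cL : Continuous (Δ η) := continuous_laplacian hη2
  have hdiv : Continuous (VectorCalculus.divergence η) := continuous_divergence cD
  haveI := isFiniteMeasure_restrict_cylinder a b x₀ R
  have hv1 : Integrable (uncurry v) μS := hv.integrable one_le_two
  have hv2 : Integrable (fun z => ‖uncurry v z‖ ^ 2) μS :=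
    (memLp_two_iff_integrable_sq_norm hv.1).1 hv
  constructor
  · refine Integrable.mono' (hv1.norm.mul_const K₀)
      (hv.1.inner (hη.contDiff.continuous.comp continuous_snd).aestronglyMeasurable)
      (Eventually.of_forall fun w => ?_)
    exact (norm_inner_le_norm _ _).trans (mul_le_mul_of_nonneg_left (hK₀ w.2) (norm_nonneg _))
  · -- the quadratic term
    have i1 : Integrable (fun w : ℝ × (EuclideanSpace ℝ (Fin 3)) => ⟪v w.1 w.2, fderiv ℝ η w.2 (v w.1 w.2)⟫) μS := by
      have hm : AEStronglyMeasurable (fun w : ℝ × (EuclideanSpace ℝ (Fin 3)) => ⟪v w.1 w.2, fderiv ℝ η w.2 (v w.1 w.2)⟫) μS :=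
        hv.1.inner (isBoundedBilinearMap_apply.continuous.comp_aestronglyMeasurable
          ((cD.comp continuous_snd).aestronglyMeasurable.prodMk hv.1))
      refine Integrable.mono' (hv2.const_mul K₁) hm (Eventually.of_forall fun w => ?_)
      calc ‖⟪v w.1 w.2, fderiv ℝ η w.2 (v w.1 w.2)⟫‖
          ≤ ‖v w.1 w.2‖ * ‖fderiv ℝ η w.2 (v w.1 w.2)‖ := norm_inner_le_norm _ _
        _ ≤ ‖v w.1 w.2‖ * (K₁ * ‖v w.1 w.2‖) := by
            gcongr
            exact (ContinuousLinearMap.le_opNorm _ _).trans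
              (mul_le_mul_of_nonneg_right (hK₁ w.2) (norm_nonneg _))
        _ = K₁ * ‖uncurry v w‖ ^ 2 := by simp only [uncurry]; ring
    -- the Laplacian term
    have i2 : Integrable (fun w : ℝ × (EuclideanSpace ℝ (Fin 3)) => ν * ⟪v w.1 w.2, Δ η w.2⟫) μS := by
      refine (Integrable.mono' (hv1.norm.mul_const K₂)
        (hv.1.inner (cL.comp continuous_snd).aestronglyMeasurable)
        (Eventually.of_forall fun w => ?_)).const_mul ν
      exact (norm_inner_le_norm _ _).trans (mul_le_mul_of_nonneg_left (hK₂ w.2) (norm_nonneg _))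
    -- the pressure term
    have i3 : Integrable (fun w : ℝ × (EuclideanSpace ℝ (Fin 3)) => π w.1 w.2 * VectorCalculus.divergence η w.2) μS := by
      have e : (fun w : ℝ × (EuclideanSpace ℝ (Fin 3)) => π w.1 w.2 * VectorCalculus.divergence η w.2) =
          fun w => VectorCalculus.divergence η w.2 * uncurry π w := by
        ext w
        simp [uncurry, mul_comm]
      rw [e]
      exact hπ.bdd_mul (hdiv.comp continuous_snd).aestronglyMeasurable
        (Eventually.of_forall fun w => norm_divergence_le_three_mul hK₁ w.2)
    exact (i1.add i2).add i3

/-- **The pairing and the tested remainder are integrable in time** on `(a, b)`: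
`g_η(t) = ∫_B ⟪v(t), η⟫` and `f_η(t) = ∫_B (⟪v, Dη v⟫ + ν ⟪v, Δη⟫ + π div η)(t)` (Fubini on the
cylinder). [folklore] -/
theorem integrableOn_pairing_cylinder
    (hv : MemLp (uncurry v) 2 ((volume : Measure (ℝ × (EuclideanSpace ℝ (Fin 3)))).restrict (Ioo a b ×ˢ ball x₀ R)))
    (hπ : Integrable (uncurry π) ((volume : Measure (ℝ × (EuclideanSpace ℝ (Fin 3)))).restrict (Ioo a b ×ˢ ball x₀ R)))
    {η : (EuclideanSpace ℝ (Fin 3)) → (EuclideanSpace ℝ (Fin 3))} (hη : FunctionSpaces.IsTestFunctionOn (⟨ball x₀ R, isOpen_ball⟩ : Opens (EuclideanSpace ℝ (Fin 3))) η) :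
    IntegrableOn (fun t => ∫ x in ball x₀ R, ⟪v t x, η x⟫) (Ioo a b) volume ∧
      IntegrableOn (fun t => ∫ x in ball x₀ R, (⟪v t x, fderiv ℝ η x (v t x)⟫ +
        ν * ⟪v t x, Δ η x⟫ + π t x * VectorCalculus.divergence η x)) (Ioo a b) volume := by
  obtain ⟨iU, iG⟩ := integrable_pairing_integrands_cylinder (ν := ν) hv hπ hη
  rw [volume_restrict_cylinder_eq_prod] at iU iG
  exact ⟨iU.integral_prod_left, iG.integral_prod_left⟩

/-- **Testing the momentum equation with `χ(t) η(x)` on the cylinder `(a, b) × B_R(x₀)`.** For a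
distributional solution `(v, π)` on `W = (a, b) × B_R(x₀)` (viscosity `ν`, no force) with
`v ∈ L²(W)`, `π ∈ L¹(W)`, a smooth `χ` compactly supported in `(a, b)` and a test field `η` on the
ball, `∫_{(a,b)} (χ'(t) g_η(t) + χ(t) f_η(t)) dt = 0` — the distributional identity for the
space–time test field `ψ = χ ⊗ η` followed by Fubini (Temam 1977, Ch. III, Lemma 1.1;
Robinson–Rodrigo–Sadowski 2016, Lemma 13.8; Galdi 2000, Lemma 2.1). [folklore] -/
theorem IsDistributionalNSSolutionOn.setIntegral_deriv_mul_pairing_add_eq_zero_cylinder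
    (hsol : IsDistributionalNSSolutionOn (timeCylinder (⟨ball x₀ R, isOpen_ball⟩ : Opens (EuclideanSpace ℝ (Fin 3))) a b) ν 0 v π)
    (hv : MemLp (uncurry v) 2 ((volume : Measure (ℝ × (EuclideanSpace ℝ (Fin 3)))).restrict (Ioo a b ×ˢ ball x₀ R)))
    (hπ : Integrable (uncurry π) ((volume : Measure (ℝ × (EuclideanSpace ℝ (Fin 3)))).restrict (Ioo a b ×ˢ ball x₀ R)))
    {χ : ℝ → ℝ} (hχ : ContDiff ℝ (⊤ : ℕ∞) χ) (hχc : HasCompactSupport χ)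
    (hχI : tsupport χ ⊆ Ioo a b) {η : (EuclideanSpace ℝ (Fin 3)) → (EuclideanSpace ℝ (Fin 3))} (hη : FunctionSpaces.IsTestFunctionOn (⟨ball x₀ R, isOpen_ball⟩ : Opens (EuclideanSpace ℝ (Fin 3))) η) :
    ∫ t in Ioo a b,
      ((deriv χ t * ∫ x in ball x₀ R, ⟪v t x, η x⟫) +
        χ t * ∫ x in ball x₀ R, (⟪v t x, fderiv ℝ η x (v t x)⟫ + ν * ⟪v t x, Δ η x⟫ +
          π t x * VectorCalculus.divergence η x)) = 0 := by
  have hηd : Differentiable ℝ η := hη.contDiff.differentiable (by simp)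
  have hη2 : ContDiff ℝ 2 η := hη.contDiff.of_le (by norm_cast)
  have hχd : Differentiable ℝ χ := hχ.differentiable (by simp)
  -- the distributional identity for `ψ = χ ⊗ η`, a test field on the cylinder
  have hψ : IsSpaceTimeTestOn (timeCylinder (⟨ball x₀ R, isOpen_ball⟩ : Opens (EuclideanSpace ℝ (Fin 3))) a b) (fun s x => χ s • η x) :=
    isSpaceTimeTestOn_prod_smul isOpen_Ioo isOpen_ball hχ hχc hχI hη
  have key := hsol.2.2.2.2 _ hψ
  set G : ℝ × (EuclideanSpace ℝ (Fin 3)) → ℝ := fun w =>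
    ⟪v w.1 w.2, fderiv ℝ η w.2 (v w.1 w.2)⟫ + ν * ⟪v w.1 w.2, Δ η w.2⟫ +
      π w.1 w.2 * VectorCalculus.divergence η w.2 with hG
  set F : ℝ × (EuclideanSpace ℝ (Fin 3)) → ℝ := fun w => deriv χ w.1 * ⟪v w.1 w.2, η w.2⟫ + χ w.1 * G w with hF
  have key' : ∫ w in Ioo a b ×ˢ ball x₀ R, F w = 0 := by
    rw [coe_timeCylinder] at key
    refine Eq.trans (setIntegral_congr_fun (measurableSet_Ioo.prod measurableSet_ball)
      fun w _ => ?_) key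
    rw [hF, hG]
    dsimp only
    rw [timeDeriv_prod_smul hχd, convect_fun_const_smul _ (hηd w.2),
      laplacian_fun_const_smul hη2, divergence_fun_const_smul (hηd w.2)]
    simp only [inner_smul_right, Pi.zero_apply, inner_zero_left, convect]
    ring
  -- integrability on the cylinder and Fubini
  obtain ⟨Cχ, hCχ⟩ := hχ.continuous.bounded_above_of_compact_support hχc
  obtain ⟨Cχ', hCχ'⟩ := (hχ.continuous_deriv (by simp)).bounded_above_of_compact_support hχc.deriv
  obtain ⟨iU, iG⟩ := integrable_pairing_integrands_cylinder (ν := ν) hv hπ hη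
  rw [volume_restrict_cylinder_eq_prod] at iU iG
  have iU' : Integrable (fun w : ℝ × (EuclideanSpace ℝ (Fin 3)) => deriv χ w.1 * ⟪v w.1 w.2, η w.2⟫)
      (((volume : Measure ℝ).restrict (Ioo a b)).prod ((volume : Measure (EuclideanSpace ℝ (Fin 3))).restrict (ball x₀ R))) :=
    integrable_time_mul iU (hχ.continuous_deriv (by simp)) (C := Cχ')
      fun s => by simpa [Real.norm_eq_abs] using hCχ' s
  have iG' : Integrable (fun w : ℝ × (EuclideanSpace ℝ (Fin 3)) => χ w.1 * G w)
      (((volume : Measure ℝ).restrict (Ioo a b)).prod ((volume : Measure (EuclideanSpace ℝ (Fin 3))).restrict (ball x₀ R))) :=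
    integrable_time_mul iG hχ.continuous (C := Cχ) fun s => by simpa [Real.norm_eq_abs] using hCχ s
  have iS : Integrable F
      (((volume : Measure ℝ).restrict (Ioo a b)).prod ((volume : Measure (EuclideanSpace ℝ (Fin 3))).restrict (ball x₀ R))) :=
    iU'.add iG'
  rw [volume_restrict_cylinder_eq_prod, integral_prod _ iS] at key'
  have hae : ∀ᵐ t ∂((volume : Measure ℝ).restrict (Ioo a b)),
      (∫ x in ball x₀ R, F (t, x)) =
        (deriv χ t * ∫ x in ball x₀ R, ⟪v t x, η x⟫) + χ t * ∫ x in ball x₀ R, G (t, x) := by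
    filter_upwards [iU.prod_right_ae, iG.prod_right_ae] with t h1 h2
    have e : (fun x => F (t, x)) = fun x => deriv χ t * ⟪v t x, η x⟫ + χ t * G (t, x) := rfl
    rw [e, integral_add (h1.const_mul _) (h2.const_mul _), MeasureTheory.integral_const_mul,
      MeasureTheory.integral_const_mul]
  rw [integral_congr_ae hae] at key'
  exact key'

/-! ### Uniform bounds: the pairing a.e. in time, the remainder on subintervals -/

/-- `x ≤ 1 + x²` in `ℝ≥0∞`. [folklore] -/
theorem _root_.ENNReal.le_one_add_sq (x : ℝ≥0∞) : x ≤ 1 + x ^ 2 := by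
  rcases le_total x 1 with h | h
  · exact h.trans le_self_add
  · calc x = x * 1 := (mul_one x).symm
      _ ≤ x * x := by gcongr
      _ = x ^ 2 := (sq x).symm
      _ ≤ 1 + x ^ 2 := le_add_self

/-- **A.e. bound on the pairing** `g_η(t) = ∫_B ⟪v(t), η⟫`: if `∫_B |v(t)|² ≤ C` for a.e. `t` and
`|η| ≤ K₀`, then `‖g_η(t)‖ₑ ≤ K₀ (|B| + C)` for a.e. `t` (via `|v| ≤ 1 + |v|²`). [folklore] -/
theorem ae_enorm_pairing_le {B : Set (EuclideanSpace ℝ (Fin 3))} {C : ℝ≥0∞}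
    (hE : ∀ᵐ t ∂((volume : Measure ℝ).restrict (Ioo a b)), ∫⁻ x in B, ‖v t x‖ₑ ^ 2 ≤ C)
    {η : (EuclideanSpace ℝ (Fin 3)) → (EuclideanSpace ℝ (Fin 3))} {K₀ : ℝ} (hK₀ : ∀ x, ‖η x‖ ≤ K₀) :
    ∀ᵐ t ∂((volume : Measure ℝ).restrict (Ioo a b)),
      ‖∫ x in B, ⟪v t x, η x⟫‖ₑ ≤ ENNReal.ofReal K₀ * (volume B + C) := by
  filter_upwards [hE] with t ht
  calc ‖∫ x in B, ⟪v t x, η x⟫‖ₑ ≤ ∫⁻ x in B, ‖⟪v t x, η x⟫‖ₑ := enorm_integral_le_lintegral_enorm _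
    _ ≤ ∫⁻ x in B, ENNReal.ofReal K₀ * ‖v t x‖ₑ := by
        refine lintegral_mono fun x => ?_
        rw [← ofReal_norm, ← ofReal_norm, ← ENNReal.ofReal_mul (le_trans (norm_nonneg _) (hK₀ x))]
        refine ENNReal.ofReal_le_ofReal ?_
        calc ‖⟪v t x, η x⟫‖ ≤ ‖v t x‖ * ‖η x‖ := norm_inner_le_norm _ _
          _ ≤ ‖v t x‖ * K₀ := by gcongr; exact hK₀ x
          _ = K₀ * ‖v t x‖ := mul_comm _ _
    _ = ENNReal.ofReal K₀ * ∫⁻ x in B, ‖v t x‖ₑ :=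
        lintegral_const_mul' _ _ ENNReal.ofReal_ne_top
    _ ≤ ENNReal.ofReal K₀ * ∫⁻ x in B, (1 + ‖v t x‖ₑ ^ 2) := by
        gcongr with x
        exact ENNReal.le_one_add_sq _
    _ = ENNReal.ofReal K₀ * (volume B + ∫⁻ x in B, ‖v t x‖ₑ ^ 2) := by
        rw [lintegral_add_left measurable_const, lintegral_const, Measure.restrict_apply_univ,
          one_mul]
    _ ≤ ENNReal.ofReal K₀ * (volume B + C) := by gcongr

/-- Pointwise bound on the remainder integrand:
`‖⟪v, Dη v⟫ + ν ⟪v, Δη⟫ + π div η‖ₑ ≤ K₁ ‖v‖ₑ² + |ν| K₂ ‖v‖ₑ + 3 K₁ ‖π‖ₑ`. [folklore] -/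
theorem enorm_remainder_integrand_le {η : (EuclideanSpace ℝ (Fin 3)) → (EuclideanSpace ℝ (Fin 3))} {K₁ K₂ : ℝ} (hK₁ : ∀ x, ‖fderiv ℝ η x‖ ≤ K₁)
    (hK₂ : ∀ x, ‖Δ η x‖ ≤ K₂) (w : (EuclideanSpace ℝ (Fin 3))) (q : ℝ) (x : (EuclideanSpace ℝ (Fin 3))) :
    ‖⟪w, fderiv ℝ η x w⟫ + ν * ⟪w, Δ η x⟫ + q * VectorCalculus.divergence η x‖ₑ ≤
      ENNReal.ofReal K₁ * ‖w‖ₑ ^ 2 + ENNReal.ofReal (|ν| * K₂) * ‖w‖ₑ +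
        ENNReal.ofReal (3 * K₁) * ‖q‖ₑ := by
  have hK₁0 : 0 ≤ K₁ := le_trans (norm_nonneg _) (hK₁ x)
  have hK₂0 : 0 ≤ K₂ := le_trans (norm_nonneg _) (hK₂ x)
  have h1 : ‖⟪w, fderiv ℝ η x w⟫‖ ≤ K₁ * ‖w‖ ^ 2 :=
    calc ‖⟪w, fderiv ℝ η x w⟫‖ ≤ ‖w‖ * ‖fderiv ℝ η x w‖ := norm_inner_le_norm _ _
      _ ≤ ‖w‖ * (K₁ * ‖w‖) := by
          gcongr
          exact (ContinuousLinearMap.le_opNorm _ _).trans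
            (mul_le_mul_of_nonneg_right (hK₁ x) (norm_nonneg _))
      _ = K₁ * ‖w‖ ^ 2 := by ring
  have h2 : ‖ν * ⟪w, Δ η x⟫‖ ≤ |ν| * K₂ * ‖w‖ := by
    rw [norm_mul, Real.norm_eq_abs, mul_assoc]
    gcongr
    calc ‖⟪w, Δ η x⟫‖ ≤ ‖w‖ * ‖Δ η x‖ := norm_inner_le_norm _ _
      _ ≤ ‖w‖ * K₂ := by gcongr; exact hK₂ x
      _ = K₂ * ‖w‖ := mul_comm _ _
  have h3 : ‖q * VectorCalculus.divergence η x‖ ≤ 3 * K₁ * ‖q‖ := by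
    rw [norm_mul, mul_comm]
    gcongr
    exact norm_divergence_le_three_mul hK₁ x
  have e1 : ENNReal.ofReal K₁ * ‖w‖ₑ ^ 2 = ENNReal.ofReal (K₁ * ‖w‖ ^ 2) := by
    rw [ENNReal.ofReal_mul hK₁0, ← ofReal_norm, ENNReal.ofReal_pow (norm_nonneg _)]
  have e2 : ENNReal.ofReal (|ν| * K₂) * ‖w‖ₑ = ENNReal.ofReal (|ν| * K₂ * ‖w‖) := by
    rw [ENNReal.ofReal_mul (mul_nonneg (abs_nonneg _) hK₂0), ← ofReal_norm]
  have e3 : ENNReal.ofReal (3 * K₁) * ‖q‖ₑ = ENNReal.ofReal (3 * K₁ * ‖q‖) := by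
    rw [← ofReal_norm, ← ENNReal.ofReal_mul (by positivity)]
  rw [e1, e2, e3, ← ENNReal.ofReal_add (by positivity) (by positivity),
    ← ENNReal.ofReal_add (by positivity) (by positivity), ← ofReal_norm]
  refine ENNReal.ofReal_le_ofReal ?_
  calc ‖⟪w, fderiv ℝ η x w⟫ + ν * ⟪w, Δ η x⟫ + q * VectorCalculus.divergence η x‖
      ≤ ‖⟪w, fderiv ℝ η x w⟫ + ν * ⟪w, Δ η x⟫‖ + ‖q * VectorCalculus.divergence η x‖ :=
        norm_add_le _ _
    _ ≤ ‖⟪w, fderiv ℝ η x w⟫‖ + ‖ν * ⟪w, Δ η x⟫‖ + ‖q * VectorCalculus.divergence η x‖ := by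
        gcongr; exact norm_add_le _ _
    _ ≤ K₁ * ‖w‖ ^ 2 + |ν| * K₂ * ‖w‖ + 3 * K₁ * ‖q‖ := by gcongr

/-- Slices of a jointly a.e.-strongly measurable function on the cylinder are a.e.-strongly
measurable on the ball for a.e. time. [folklore] -/
theorem ae_aestronglyMeasurable_slice_cylinder {F : Type*} [NormedAddCommGroup F]
    {f : ℝ → (EuclideanSpace ℝ (Fin 3)) → F} {B : Set (EuclideanSpace ℝ (Fin 3))}
    (hm : AEStronglyMeasurable (uncurry f) ((volume : Measure (ℝ × (EuclideanSpace ℝ (Fin 3)))).restrict (Ioo a b ×ˢ B))) :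
    ∀ᵐ t ∂((volume : Measure ℝ).restrict (Ioo a b)),
      AEStronglyMeasurable (f t) ((volume : Measure (EuclideanSpace ℝ (Fin 3))).restrict B) := by
  rw [volume_restrict_cylinder_eq_prod] at hm
  filter_upwards [hm.prodMk_left] with t ht
  exact ht

/-- **A.e. bound on the tested remainder** `f_η(t)`: if `∫_B |v(t)|² ≤ C` for a.e. `t` then for
a.e. `t`, `‖f_η(t)‖ₑ ≤ K₁ C + |ν| K₂ (|B| + C) + 3K₁ ∫_B |π(t)|`. [folklore] -/
theorem ae_enorm_remainder_le {B : Set (EuclideanSpace ℝ (Fin 3))} {C : ℝ≥0∞}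
    (hmv : AEStronglyMeasurable (uncurry v) ((volume : Measure (ℝ × (EuclideanSpace ℝ (Fin 3)))).restrict (Ioo a b ×ˢ B)))
    (hmπ : AEStronglyMeasurable (uncurry π) ((volume : Measure (ℝ × (EuclideanSpace ℝ (Fin 3)))).restrict (Ioo a b ×ˢ B)))
    (hE : ∀ᵐ t ∂((volume : Measure ℝ).restrict (Ioo a b)), ∫⁻ x in B, ‖v t x‖ₑ ^ 2 ≤ C)
    {η : (EuclideanSpace ℝ (Fin 3)) → (EuclideanSpace ℝ (Fin 3))} {K₁ K₂ : ℝ} (hK₁ : ∀ x, ‖fderiv ℝ η x‖ ≤ K₁) (hK₂ : ∀ x, ‖Δ η x‖ ≤ K₂) :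
    ∀ᵐ t ∂((volume : Measure ℝ).restrict (Ioo a b)),
      ‖∫ x in B, (⟪v t x, fderiv ℝ η x (v t x)⟫ + ν * ⟪v t x, Δ η x⟫ +
          π t x * VectorCalculus.divergence η x)‖ₑ ≤
        ENNReal.ofReal K₁ * C + ENNReal.ofReal (|ν| * K₂) * (volume B + C) +
          ENNReal.ofReal (3 * K₁) * ∫⁻ x in B, ‖π t x‖ₑ := by
  filter_upwards [hE, ae_aestronglyMeasurable_slice_cylinder hmv,
    ae_aestronglyMeasurable_slice_cylinder hmπ] with t ht hv hπ
  have hv' : AEMeasurable (fun x => ‖v t x‖ₑ) ((volume : Measure (EuclideanSpace ℝ (Fin 3))).restrict B) :=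
    hv.aemeasurable.enorm
  calc ‖∫ x in B, (⟪v t x, fderiv ℝ η x (v t x)⟫ + ν * ⟪v t x, Δ η x⟫ +
          π t x * VectorCalculus.divergence η x)‖ₑ
      ≤ ∫⁻ x in B, ‖⟪v t x, fderiv ℝ η x (v t x)⟫ + ν * ⟪v t x, Δ η x⟫ +
          π t x * VectorCalculus.divergence η x‖ₑ := enorm_integral_le_lintegral_enorm _
    _ ≤ ∫⁻ x in B, (ENNReal.ofReal K₁ * ‖v t x‖ₑ ^ 2 + ENNReal.ofReal (|ν| * K₂) * ‖v t x‖ₑ +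
          ENNReal.ofReal (3 * K₁) * ‖π t x‖ₑ) :=
        lintegral_mono fun x => enorm_remainder_integrand_le hK₁ hK₂ _ _ _
    _ = ENNReal.ofReal K₁ * (∫⁻ x in B, ‖v t x‖ₑ ^ 2) +
          ENNReal.ofReal (|ν| * K₂) * (∫⁻ x in B, ‖v t x‖ₑ) +
          ENNReal.ofReal (3 * K₁) * ∫⁻ x in B, ‖π t x‖ₑ := by
        have m1 : AEMeasurable (fun x => ENNReal.ofReal K₁ * ‖v t x‖ₑ ^ 2)
            ((volume : Measure (EuclideanSpace ℝ (Fin 3))).restrict B) := (hv'.pow_const 2).const_mul _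
        have m2 : AEMeasurable (fun x => ENNReal.ofReal K₁ * ‖v t x‖ₑ ^ 2 +
            ENNReal.ofReal (|ν| * K₂) * ‖v t x‖ₑ) ((volume : Measure (EuclideanSpace ℝ (Fin 3))).restrict B) :=
          m1.add (hv'.const_mul _)
        rw [lintegral_add_left' m2, lintegral_add_left' m1,
          lintegral_const_mul' _ _ ENNReal.ofReal_ne_top,
          lintegral_const_mul' _ _ ENNReal.ofReal_ne_top,
          lintegral_const_mul' _ _ ENNReal.ofReal_ne_top]
    _ ≤ ENNReal.ofReal K₁ * C + ENNReal.ofReal (|ν| * K₂) * (volume B + C) +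
          ENNReal.ofReal (3 * K₁) * ∫⁻ x in B, ‖π t x‖ₑ := by
        gcongr
        calc ∫⁻ x in B, ‖v t x‖ₑ ≤ ∫⁻ x in B, (1 + ‖v t x‖ₑ ^ 2) :=
              lintegral_mono fun x => ENNReal.le_one_add_sq _
          _ = volume B + ∫⁻ x in B, ‖v t x‖ₑ ^ 2 := by
              rw [lintegral_add_left measurable_const, lintegral_const, Measure.restrict_apply_univ,
                one_mul]
          _ ≤ volume B + C := by gcongr

/-- **The pressure on subcylinders**: `∫_{(s,t)} ∫_B |π| ≤ (|(s,t)| |B|)^{1/3} C^{2/3}` whenever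
`∬_{(a,b)×B} |π|^{3/2} ≤ C` and `a ≤ s`, `t ≤ b` (Tonelli and Hölder against `1`). [folklore] -/
theorem setLIntegral_Ioc_pressure_le {B : Set (EuclideanSpace ℝ (Fin 3))} {C : ℝ≥0∞}
    (hmπ : AEStronglyMeasurable (uncurry π) ((volume : Measure (ℝ × (EuclideanSpace ℝ (Fin 3)))).restrict (Ioo a b ×ˢ B)))
    (hP : ∫⁻ z in Ioo a b ×ˢ B, ‖π z.1 z.2‖ₑ ^ (3 / 2 : ℝ) ≤ C) {s t : ℝ} (hs : a ≤ s) (ht : t ≤ b) :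
    ∫⁻ τ in Ioc s t, ∫⁻ x in B, ‖π τ x‖ₑ ≤
      (volume (Ioo s t) * volume B) ^ (1 / 3 : ℝ) * C ^ (2 / 3 : ℝ) := by
  have hsub : Ioo s t ×ˢ B ⊆ Ioo a b ×ˢ B := prod_mono (Ioo_subset_Ioo hs ht) Subset.rfl
  have hm' : AEStronglyMeasurable (uncurry π) ((volume : Measure (ℝ × (EuclideanSpace ℝ (Fin 3)))).restrict (Ioo s t ×ˢ B)) :=
    hmπ.mono_measure (Measure.restrict_mono hsub le_rfl)
  rw [setLIntegral_congr (Ioo_ae_eq_Ioc (μ := (volume : Measure ℝ)) (a := s) (b := t)).symm]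
  have h := setLIntegral_cylinder_eq (a := s) (b := t) (B := B)
    (F := fun z => ‖uncurry π z‖ₑ) hm'.aemeasurable.enorm
  simp only [uncurry] at h
  rw [← h]
  calc ∫⁻ z in Ioo s t ×ˢ B, ‖π z.1 z.2‖ₑ
      ≤ volume (Ioo s t ×ˢ B) ^ (1 / 3 : ℝ) *
          (∫⁻ z in Ioo s t ×ˢ B, ‖π z.1 z.2‖ₑ ^ (3 / 2 : ℝ)) ^ (2 / 3 : ℝ) :=
        setLIntegral_enorm_le_of_three_halves (p := uncurry π) hm'
    _ ≤ (volume (Ioo s t) * volume B) ^ (1 / 3 : ℝ) * C ^ (2 / 3 : ℝ) := by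
        gcongr
        · rw [Measure.volume_eq_prod, Measure.prod_prod]
        · exact (lintegral_mono_set hsub).trans hP

end Cylinder

end Literature.Analysis.FluidPDE

end
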